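import Literature.MathematicalPhysics.QuantumFieldTheory.ConformalBootstrap3D.PointKernelIdentity

/-!
# Point-certificate kernel evaluator: the unbounded box `[s_lo, s_hi] × [ε_lo, ∞)`

`PCert.boxExcluded_of_kernelC` (kernel certificate theorem, (O1) in chord form) concludes
`BoxExcluded ([s_lo, s_hi] × [ε_lo, E₀))`: the light-block obligation (O2) at `(Δ_ε, ℓ = 0)` is read
off a head cell, and head cells stop at `E₀`.  For `Δ_ε ≥ E₀` the obligation is ALREADY covered by
the certificate's tail rules — (M) on `[E₀, E_T)` and the apex inequality (T) give block positivity at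
every `(Δ, ℓ)` with `Δ ≥ E₀` (`tail_nonneg_pointFunctional_of_termwise_and_apex_twist`), in particular
at `ℓ = 0` (the move of `PointCertificateTableUnbounded`).  So the SAME kernel data certify the
unbounded box `[s_lo, s_hi] × [ε_lo, ∞)` (one extra trivial side condition `1/2 ≤ E₀`):

* `boxExcluded_of_pointTable_twist_unboundedI` — the one-bit table theorem
  `boxExcluded_of_pointTable_twistI` with `Q ⊆ [s_lo, s_hi] × [ε_lo, ∞)`;
* `QBoxU`, `PCert.boxExcluded_of_kernelC_unbounded : … → BoxExcluded (QBoxU slo shi εlo)` with the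
  hypothesis list of `PCert.boxExcluded_of_kernelC` verbatim plus `1/2 ≤ E₀`, so that every landed
  kernel instance (pub-ising3d `PointKernelK34.boxExcluded_K34`, box `[0.5175, 0.5185] × [1.6, 24)`)
  upgrades to its production strip (`[1.6, ∞)`) by re-using its block theorems.

Term basis: Hogervorst–Rychkov 2013, §3 eq. (3.6). [cite: HogervorstRychkov2013, §3 eq. (3.6)]
-/

namespace Literature.MathematicalPhysics.QuantumFieldTheory.ConformalBootstrap3D

open Literature.Analysis.ValidatedNumerics (rsum rall vget vtab vget_vtab vget_of_length_le rsum_eq_sum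
  rall_eq_true_iff of_rall)
open Literature.Analysis.ValidatedNumerics.NumericsMP
open Real Finset Set

/-! ### The one-bit table theorem on the unbounded box -/

/-- **The point-functional certificate as a finite table, twist-gap domain, identity obligation
direct, unbounded `Δ_ε`-range.**  As `boxExcluded_of_pointTable_twistI` with
`Q ⊆ [s_lo, s_hi] × [ε_lo, ∞)` and the extra side condition `1/2 ≤ E₀`: (O2) below `E₀` from the
scalar row's cells, above `E₀` from (M)+(T). [cite: HogervorstRychkov2013, §3 eq. (3.6)] -/
theorem boxExcluded_of_pointTable_twist_unboundedI {N : ℕ} {w z zb : Fin N → ℝ}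
    (hz : ∀ k, z k ∈ Ioo (0 : ℝ) 1) (hzb : ∀ k, zb k ∈ Ioo (0 : ℝ) 1) (hord : ∀ k, zb k ≤ z k)
    (apex : Fin N) (hapex : 0 ≤ w apex) (qd qr : Fin N → ℝ) (hqd : ∀ k, 0 < qd k ∧ qd k ≤ 1)
    (hqr : ∀ k, 0 < qr k ∧ qr k ≤ 1)
    (hdomd : ∀ k, z k * zb k ≤ qd k ^ 2 * (z apex * zb apex) ∧ z k ≤ qd k * z apex)
    (hdomr : ∀ k, (1 - z k) * (1 - zb k) ≤ qr k ^ 2 * (z apex * zb apex) ∧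
      1 - zb k ≤ qr k * z apex)
    {Q : Set (ℝ × ℝ)} {slo shi εlo E₀ ET τ : ℝ}
    (hQ : ∀ p ∈ Q, (slo ≤ p.1 ∧ p.1 ≤ shi) ∧ εlo ≤ p.2)
    (hε3 : εlo ≤ 3) (L : ℕ) (hL : E₀ ≤ (L : ℝ) + 1) (hτ1 : τ ≤ 1) (hτ0 : τ ≤ E₀)
    (hE0 : 1 / 2 ≤ E₀)
    (hr : ∀ k, 1 / 2 ≤ ((1 - z k) * (1 - zb k)) ^ (shi - slo) ∧ 1 / 2 ≤ (z k * zb k) ^ (shi - slo))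
    -- (O1), on `Q` itself
    (hI : ∀ p ∈ Q, 0 < pointFunctional w z zb (crossF p.1 (-1) (fun _ _ => (1 : ℝ))))
    -- head rows
    (t : ℕ → ℕ → ℝ) (K : ℕ → ℕ) (nF : ℕ → ℕ → ℕ) (hc : ℕ → ℕ → Bool)
    (ht0 : t 0 0 = εlo ∧ t 0 (K 0) = E₀)
    (htℓ : ∀ ℓ, Even ℓ → ℓ ≠ 0 → ℓ < L → t ℓ 0 = (ℓ : ℝ) + 1 ∧ t ℓ (K ℓ) = E₀)
    (hlow : ∀ ℓ k, k < K ℓ → (ℓ : ℝ) + 1 ≤ t ℓ k)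
    (hnF : ∀ ℓ k, k < K ℓ → E₀ ≤ t ℓ k + ((nF ℓ k : ℝ) + 1))
    (hρ : ∀ ℓ k, k < K ℓ → hc ℓ k = true → ∀ i, 1 / 2 ≤ (z i * zb i) ^ ((t ℓ (k + 1) - t ℓ k) / 2) ∧
      1 / 2 ≤ ((1 - z i) * (1 - zb i)) ^ ((t ℓ (k + 1) - t ℓ k) / 2))
    (hhead : ∀ ℓ, (ℓ = 0 ∨ (Even ℓ ∧ ℓ < L)) → ∀ k < K ℓ,
      0 ≤ headNumber w z zb ℓ (t ℓ k) (t ℓ (k + 1)) slo shi (nF ℓ k) (hc ℓ k))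
    -- (M) box rows
    (e : ℕ → ℕ → ℝ) (M : ℕ → ℕ) (bc : ℕ → ℕ → Bool)
    (he : ∀ j : ℕ, (j : ℝ) + τ < ET → e j 0 ≤ max E₀ ((j : ℝ) + τ) ∧ ET ≤ e j (M j))
    (hρM : ∀ j m, m < M j → bc j m = true → ∀ k, 1 / 2 ≤ (z k * zb k) ^ ((e j (m + 1) - e j m) / 2) ∧
      1 / 2 ≤ ((1 - z k) * (1 - zb k)) ^ ((e j (m + 1) - e j m) / 2))
    (hbox : ∀ j : ℕ, (j : ℝ) + τ < ET → ∀ m < M j,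
      0 ≤ boxNumber w z zb j (e j m) (e j (m + 1)) slo shi (bc j m))
    -- (T)
    (hB : ∑ k ∈ univ.erase apex, |w k| * ((1 - z k) * (1 - zb k)) ^ slo * qd k ^ ET
          + ∑ k, |w k| * (z k * zb k) ^ slo * qr k ^ ET ≤
          w apex * ((1 - z apex) * (1 - zb apex)) ^ shi) :
    BoxExcluded Q := by
  have hQ1 : ∀ p ∈ Q, slo ≤ p.1 ∧ p.1 ≤ shi := fun p hp => (hQ p hp).1
  have hM := ruleM_of_boxTable_twist w z zb hz hzb τ hQ1 hr e M bc he hρM hbox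
  -- every cell of every row
  have hcell : ∀ ℓ, (ℓ = 0 ∨ (Even ℓ ∧ ℓ < L)) → ∀ k < K ℓ, ∀ p ∈ Q,
      ∀ Δ ∈ Ico (t ℓ k) (t ℓ (k + 1)), BlockPositive (pointFunctional w z zb) p.1 Δ ℓ :=
    fun ℓ hℓ k hk => cell_of_headNumber_twist w z zb hz hzb hord apex hapex qd qr hqd hqr hdomd hdomr
      hQ1 hτ1 hM hB hr (hlow ℓ k hk) (nF ℓ k) (hnF ℓ k hk) (hc ℓ k) (hρ ℓ k hk) (hhead ℓ hℓ k hk)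
  have htail : ∀ p ∈ Q, ∀ ℓ : ℕ, ∀ Δ : ℝ, unitarityBound3D ℓ ≤ Δ → E₀ ≤ Δ →
      BlockPositive (pointFunctional w z zb) p.1 Δ ℓ := fun p hp ℓ Δ hbd hΔ0 =>
    tail_nonneg_pointFunctional_of_termwise_and_apex_twist w z zb hz hzb hord apex hapex qd qr hqd
      hqr hdomd hdomr hQ1 hτ1 hτ0 hM hB p hp ℓ Δ hbd hΔ0
  have hb0 : unitarityBound3D 0 = 1 / 2 := by simp [unitarityBound3D]
  exact SingleCorrelatorObligations.boxExcluded (Δstar := E₀) hz hzb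
    { identity_pos := hI
      epsilon_nonneg := fun p hp => by
        by_cases h : p.2 < E₀
        · exact blockPositive_of_cells_Ico (t 0) (K 0) (hcell 0 (Or.inl rfl)) p hp p.2
            ⟨ht0.1 ▸ (hQ p hp).2, ht0.2 ▸ h⟩
        · exact htail p hp 0 p.2 (by rw [hb0]; linarith [not_lt.1 h]) (not_lt.1 h)
      scalar_nonneg := scalar_nonneg_of_cells (t 0) (K 0) (ht0.1 ▸ hε3) ht0.2 (hcell 0 (Or.inl rfl))
      spinning_nonneg := spinning_nonneg_of_cells L hL t K
        (fun ℓ hev hℓ hℓL => (htℓ ℓ hev hℓ hℓL).1.le) (fun ℓ hev hℓ hℓL => (htℓ ℓ hev hℓ hℓL).2)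
        (fun ℓ hev hℓ hℓL => hcell ℓ (Or.inr ⟨hev, hℓL⟩))
      tail_nonneg := fun p hp ℓ _ Δ hbd hΔ0 => htail p hp ℓ Δ hbd hΔ0 }

namespace PointKernel

/-- the unbounded box `[slo, shi] × [εlo, ∞)` of a certificate [folklore] -/
def QBoxU (slo shi εlo : ℚ) : Set (ℝ × ℝ) :=
  {p | (((slo : ℚ) : ℝ) ≤ p.1 ∧ p.1 ≤ ((shi : ℚ) : ℝ)) ∧ ((εlo : ℚ) : ℝ) ≤ p.2}

/-- The bounded certificate box is part of the unbounded one. [folklore] -/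
theorem qBox_subset_qBoxU (slo shi εlo E0 : ℚ) : QBox slo shi εlo E0 ⊆ QBoxU slo shi εlo :=
  fun _ hp => ⟨hp.1, hp.2.1⟩

namespace PCert

variable {c : PCert}

/-- **The kernel certificate theorem, (O1) in chord form, unbounded box.** The hypothesis list of
`PCert.boxExcluded_of_kernelC` verbatim plus `1/2 ≤ E₀`; conclusion
`BoxExcluded ([s_lo, s_hi] × [ε_lo, ∞))`. [cite: HogervorstRychkov2013, §3 eq. (3.6)] -/
theorem boxExcluded_of_kernelC_unbounded (hc : c.checkNodes = true) (hside : c.sideOK = true)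
    (tI : ℕ) (ho1 : c.o1OKC tI = true)
    (qd qr : List ℚ) (ET : ℕ) (hT : c.tOK qd qr ET = true)
    (εlo E0 τ : ℚ) (L J : ℕ) (hpar : paramOK εlo E0 τ L ET J = true) (hE0 : (1 : ℚ) / 2 ≤ E0)
    (hsegs : List HSeg) (hmetaH : hMetaOK c.rho hsegs εlo E0 L = true)
    (mrows : List MRow) (hmetaM : c.mMetaOK mrows E0 τ ET J = true)
    (hcells : ∀ i < hsegs.length, ∀ x ∈ segCells c.rho (segAt hsegs i), c.CellFact (segAt hsegs i).ell x)
    (hboxes : ∀ j < J, ∀ m < (rowAt mrows j).steps.length,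
      0 ≤ termCornerBound c.wR c.zR c.zbR j (c.eM mrows j m) (c.eM mrows j (m + 1))
        ((c.slo : ℚ) : ℝ) ((c.shi : ℚ) : ℝ)) :
    BoxExcluded (QBoxU c.slo c.shi εlo) := by
  simp only [paramOK, Bool.and_eq_true, decide_eq_true_eq] at hpar
  obtain ⟨⟨⟨⟨⟨hε3, hL⟩, hτ1⟩, hτ0⟩, hJ⟩, hL0⟩ := hpar
  obtain ⟨hqd, hqr, hdomd, hdomr, hB⟩ := t_hyps hc qd qr ET hT
  obtain ⟨ht0, htℓ, hlow, hnF, hcell⟩ := head_hyps c.rho hsegs εlo E0 L hmetaH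
  -- the facts of cell `k` of row `ℓ`
  have hF : ∀ ℓ k, k < KH c.rho hsegs ℓ → c.CellFact ℓ (cellAt c.rho hsegs ℓ k) := by
    intro ℓ k hk
    obtain ⟨-, -, i, hi, hell, hmem⟩ := hcell ℓ k hk
    have := hcells i hi _ hmem
    rwa [hell] at this
  have hhead : ∀ ℓ, (ℓ = 0 ∨ (Even ℓ ∧ ℓ < L)) → ∀ k < KH c.rho hsegs ℓ,
      0 ≤ headNumber c.wR c.zR c.zbR ℓ (tH c.rho hsegs ℓ k) (tH c.rho hsegs ℓ (k + 1)) ((c.slo : ℚ) : ℝ)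
        ((c.shi : ℚ) : ℝ) (nFH c.rho hsegs ℓ k) (bH c.rho hsegs ℓ k) := by
    intro ℓ _ k hk
    obtain ⟨e1, e2, -⟩ := hcell ℓ k hk
    rw [e1, e2, nFH, bH]
    exact (hF ℓ k hk).1
  have hρ : ∀ ℓ k, k < KH c.rho hsegs ℓ → bH c.rho hsegs ℓ k = true → ∀ i : Fin c.N,
      1 / 2 ≤ (c.zR i * c.zbR i) ^ ((tH c.rho hsegs ℓ (k + 1) - tH c.rho hsegs ℓ k) / 2) ∧
      1 / 2 ≤ ((1 - c.zR i) * (1 - c.zbR i)) ^ ((tH c.rho hsegs ℓ (k + 1) - tH c.rho hsegs ℓ k) / 2) := by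
    intro ℓ k hk hb i
    obtain ⟨e1, e2, -⟩ := hcell ℓ k hk
    rw [e1, e2]
    exact (hF ℓ k hk).2 hb i
  have hJR : ((ET : ℕ) : ℝ) ≤ (J : ℝ) + ((τ : ℚ) : ℝ) := by
    have : (((ET : ℚ)) : ℝ) ≤ (((J : ℚ) + τ : ℚ) : ℝ) := by exact_mod_cast hJ
    push_cast at this; exact this
  obtain ⟨he, hρM, hbox⟩ := ruleM_hyps mrows E0 τ ET J hJR hmetaM hboxes
  refine boxExcluded_of_pointTable_twist_unboundedI (w := c.wR) (z := c.zR) (zb := c.zbR)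
    (slo := ((c.slo : ℚ) : ℝ)) (shi := ((c.shi : ℚ) : ℝ)) (εlo := ((εlo : ℚ) : ℝ)) (E₀ := ((E0 : ℚ) : ℝ))
    (ET := ((ET : ℕ) : ℝ)) (τ := ((τ : ℚ) : ℝ))
    (zR_mem hc) (zbR_mem hc) ?_ ⟨c.apex, apex_lt hc⟩ ?_ (c.qR qd) (c.qR qr) hqd hqr hdomd hdomr
    (fun p hp => hp) (by exact_mod_cast hε3) L (by exact_mod_cast hL) (by exact_mod_cast hτ1)
    (by exact_mod_cast hτ0)
    (by have h := (Rat.cast_le (K := ℝ)).2 hE0; push_cast at h; linarith) (side_hyp hside)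
    (fun p hp => o1C_hyp hc hside tI ho1 hp.1)
    (tH c.rho hsegs) (KH c.rho hsegs) (nFH c.rho hsegs) (bH c.rho hsegs) ht0 htℓ hlow hnF
    hρ hhead (c.eM mrows) (fun j => (rowAt mrows j).steps.length)
    (fun _ _ => false) he hρM hbox hB
  · intro k
    have hn := checkNode_of_checkNodes hc k.2
    simpa [zR, zbR] using (show ((c.zb k : ℚ) : ℝ) ≤ ((c.z k : ℚ) : ℝ) by exact_mod_cast zb_le_z hn)
  · simpa [wR] using (show ((0 : ℚ) : ℝ) ≤ ((c.w c.apex : ℚ) : ℝ) by exact_mod_cast w_apex_nonneg hc)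

end PCert

end PointKernel

end Literature.MathematicalPhysics.QuantumFieldTheory.ConformalBootstrap3D
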